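import Literature.NumberTheory.Automorphic.IdeleUnitBoxShells
import Literature.NumberTheory.Automorphic.UnitIdeleArchPushforward
import Literature.NumberTheory.Automorphic.MixedSpaceExpMoment
import Literature.NumberTheory.Automorphic.KirillovL2BoundFinite
import Literature.NumberTheory.Automorphic.IdeleClassGroup
import Literature.NumberTheory.GaloisRepresentations.HeckeCharacterNormTwistProofs
import Literature.NumberTheory.GaloisRepresentations.WeakAbelianDirectSummandCyclotomicProofs
import Literature.NumberTheory.Automorphic.GLnArchimedeanFactor
import HarnessLib

/-!
# The integral in the second torus coordinate of the `GL_2` torus integral at `s = 1`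

Topic `NumberTheory/Automorphic`; namespace `Literature.NumberTheory.Automorphic`. Theorems only; part of
the plumbing of the Kirillov `L²`-bound into the bad-place Rankin–Selberg torus integral at `s = 1`
(the `n ≤ 2` case of the named fact `JacquetShalika1981_partialPairL_pole_of_eq_conj`). After the
pointwise bound of the Schwartz factor (`TorusIntegrandGL2PhiBound`) the second torus coordinate `a₁`
contributes, for a Haar measure `ν` on `𝕀_K`, a finite set `S'` of finite places and constants
`C ≥ 0`, `c > 0`, the integral

  `∫_{B(S'ᶜ)} C exp(-c ‖ι(a_∞)‖) ‖a‖² 𝟙{|a|_v ≤ 1, v ∈ S'} dν(a) < ∞`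
  (`setLIntegral_ideleUnitBox_expWeight_lt_top`):

shells at `S'` (`IdeleUnitBoxShells`), `‖ϖ^m b‖ = ∏ q_v^{-m_v} · N(ι(b_∞))` for `b ∈ 𝕌_K`, the
geometric series `Σ_{m ≥ 0} ∏ q_v^{-2m_v} = ∏ (1 - q_v^{-2})⁻¹`, the archimedean pushforward
(`UnitIdeleArchPushforward`) and the exponential moment `∫_{K_∞ˣ} exp(-c‖x‖) N(x)² d^×x < ∞`
(`MixedSpaceExpMoment`). [folklore; Tate (1967), §4.3]

## References

* J. Tate, in Cassels–Fröhlich (1967), Ch. XV §4.3 [CasselsFrohlichANT1967].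
* H. Jacquet, J. A. Shalika, Amer. J. Math. 103 (1981), §4 [JacquetShalikaAJM1981].
-/

noncomputable section

open MeasureTheory Measure NumberField NumberField.InfinitePlace NumberField.mixedEmbedding IsDedekindDomain Set WithZero
open Literature.NumberTheory.GaloisRepresentations (ideleGroup unitIdeles localUnits infiniteIdeles)
open scoped ENNReal NNReal Classical

namespace Literature.NumberTheory.Automorphic

/-! ### Products over shells: `Σ_{m ∈ ℤ^T} ∏_v g_v(m_v) = ∏_v Σ_k g_v(k)` -/

section ShellSums

variable {K : Type} [Field K] [NumberField K]

omit [NumberField K] in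
/-- **`Σ_{m ∈ ℤ^T} ∏_{v ∈ T} g_v(m_v) = ∏_{v ∈ T} Σ_{k ∈ ℤ} g_v(k)`** in `ℝ≥0∞`. [folklore] -/
theorem tsum_prod_shell_eq_prod_tsum (g : HeightOneSpectrum (𝓞 K) → ℤ → ℝ≥0∞) :
    ∀ T : Finset (HeightOneSpectrum (𝓞 K)),
      ∑' m : ↥T → ℤ, ∏ v ∈ T.attach, g v.1 (m v) = ∏ v ∈ T, ∑' k : ℤ, g v k := by
  intro T
  induction T using Finset.induction_on with
  | empty =>
    rw [Finset.prod_empty, tsum_eq_single (default : ↥(∅ : Finset (HeightOneSpectrum (𝓞 K))) → ℤ)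
      (fun m hm => absurd (Subsingleton.elim m default) hm)]
    rw [Finset.attach_empty, Finset.prod_empty]
  | insert v T hv ih =>
    rw [Finset.prod_insert hv, ← ih, ← Equiv.tsum_eq (insertShellEquiv hv), ENNReal.tsum_prod', ← ENNReal.tsum_mul_right]
    refine tsum_congr fun k => ?_
    rw [← ENNReal.tsum_mul_left]
    refine tsum_congr fun m' => ?_
    -- the product over `(insert v T).attach` as a product over `insert v T`
    set F : HeightOneSpectrum (𝓞 K) → ℝ≥0∞ := fun w =>
      if h : w = v then g v k else if hw : w ∈ T then g w (m' ⟨w, hw⟩) else 1 with hF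
    have h1 : ∀ x : ↥(insert v T), g x.1 (insertShellEquiv hv (k, m') x) = F x.1 := by
      intro x
      by_cases hx : x.1 = v
      · have hx' : x = ⟨v, Finset.mem_insert_self v T⟩ := Subtype.ext hx
        rw [hx', insertShellEquiv_apply_self, hF]
        simp
      · have hxT : x.1 ∈ T := (Finset.mem_insert.1 x.2).resolve_left hx
        have hx' : x = ⟨(⟨x.1, hxT⟩ : ↥T).1, Finset.mem_insert_of_mem hxT⟩ := Subtype.ext rfl
        rw [hx', insertShellEquiv_apply_of_mem, hF]
        simp only
        rw [dif_neg hx, dif_pos hxT]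
    have h2 : ∀ x : ↥T, g x.1 (m' x) = F x.1 := by
      intro x
      have hx : x.1 ≠ v := fun h => hv (h ▸ x.2)
      rw [hF]; simp only; rw [dif_neg hx, dif_pos x.2]
    rw [Finset.prod_congr rfl fun x _ => h1 x, Finset.prod_attach (insert v T) F, Finset.prod_insert hv,
      Finset.prod_congr rfl fun x _ => h2 x, Finset.prod_attach T F]
    congr 1
    rw [hF]; simp

/-- `Σ_{k ∈ ℤ, k ≥ 0} r^{2k} < ∞` for `r < 1` in `ℝ≥0∞`. [folklore] -/
theorem tsum_int_indicator_pow_lt_top {r : ℝ≥0∞} (hr : r < 1) :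
    ∑' k : ℤ, (if 0 ≤ k then r ^ (2 * k.toNat) else 0) < ⊤ := by
  have h : ∑' k : ℤ, (if 0 ≤ k then r ^ (2 * k.toNat) else 0) = ∑' n : ℕ, (r ^ 2) ^ n := by
    rw [← (Nat.cast_injective (R := ℤ)).tsum_eq (f := fun k : ℤ => if 0 ≤ k then r ^ (2 * k.toNat) else 0)]
    · refine tsum_congr fun n => ?_
      rw [if_pos (Int.natCast_nonneg n), Int.toNat_natCast, pow_mul]
    · intro k hk
      rw [Function.mem_support] at hk
      by_cases h0 : 0 ≤ k
      · exact ⟨k.toNat, Int.toNat_of_nonneg h0⟩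
      · exact absurd (if_neg h0) hk
  rw [h, ENNReal.tsum_geometric]
  refine ENNReal.inv_lt_top.2 (tsub_pos_iff_lt.2 ?_)
  calc r ^ 2 = r * r := pow_two r
    _ ≤ r * 1 := by gcongr
    _ = r := mul_one r
    _ < 1 := hr

end ShellSums

/-! ### The shell idele: archimedean part and norm -/

section ShellNorm

variable {K : Type} [Field K] [NumberField K]
variable (ϖ : ∀ v : HeightOneSpectrum (𝓞 K), (v.adicCompletion K)ˣ)

/-- The infinite part of `ι_v(u)` is `1`. [folklore] -/
theorem infPart_localUnits (v : HeightOneSpectrum (𝓞 K)) (u : (v.adicCompletion K)ˣ) :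
    GaloisRepresentations.HeckeCharacter.infPart K (localUnits v u) = 1 :=
  Units.ext (GaloisRepresentations.localUnits_fst v u)

/-- The archimedean coordinate of a shell idele is `1`. [folklore] -/
theorem archUnitsOfIdele_shellIdele (S' : Finset (HeightOneSpectrum (𝓞 K))) (m : ↥S' → ℤ) :
    archUnitsOfIdele K (shellIdele ϖ S' m) = 1 := by
  unfold archUnitsOfIdele shellIdele
  rw [MonoidHom.comp_apply, map_prod, Finset.prod_eq_one fun v _ => infPart_localUnits v.1 _, map_one]

/-- `(ϖ^m b)_∞ = b_∞`. [folklore] -/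
theorem archUnitsOfIdele_shellIdele_mul (S' : Finset (HeightOneSpectrum (𝓞 K))) (m : ↥S' → ℤ) (b : ideleGroup K) :
    archUnitsOfIdele K (shellIdele ϖ S' m * b) = archUnitsOfIdele K b := by
  rw [map_mul, archUnitsOfIdele_shellIdele, one_mul]

/-- `‖ι_v(ϖ^k)‖ = q_v^{-k}` (idele norm, real-valued). [folklore] -/
theorem ideleNorm_localUnits_zpow {v : HeightOneSpectrum (𝓞 K)} (hϖ : Valued.v ((ϖ v : (v.adicCompletion K)ˣ) : v.adicCompletion K) = exp (-1 : ℤ)) (k : ℤ) :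
    (IdeleClassGroup.ideleNorm K (localUnits v (ϖ v ^ k)) : ℝ) = ((v.residueCard : ℝ)⁻¹) ^ k := by
  rw [coe_ideleNorm, GaloisRepresentations.ideleNorm_localUnits, Units.val_zpow_eq_zpow_val, norm_zpow,
    norm_eq_inv_residueCard_of_valued_eq hϖ]

/-- **`‖ϖ^m‖ = ∏_{v ∈ S'} q_v^{-m_v}`.** [folklore] -/
theorem ideleNorm_shellIdele (hϖ : ∀ v, Valued.v ((ϖ v : (v.adicCompletion K)ˣ) : v.adicCompletion K) = exp (-1 : ℤ))
    (S' : Finset (HeightOneSpectrum (𝓞 K))) (m : ↥S' → ℤ) :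
    (IdeleClassGroup.ideleNorm K (shellIdele ϖ S' m) : ℝ) = ∏ v ∈ S'.attach, ((v.1.residueCard : ℝ)⁻¹) ^ (m v) := by
  rw [shellIdele, map_prod, NNReal.coe_prod]
  exact Finset.prod_congr rfl fun v _ => ideleNorm_localUnits_zpow ϖ (hϖ v.1) (m v)

/-- The norm of a local unit is `1`: the `mpr` direction of `norm_adicCompletion_eq_one_iff`
(`RankinSelbergTorusIntegral.lean`), kept as a deprecated alias (dedup-01312). [folklore] -/
@[deprecated norm_adicCompletion_eq_one_iff (since := "2026-08-16")]
theorem norm_eq_one_of_valued_eq_one {v : HeightOneSpectrum (𝓞 K)} {x : v.adicCompletion K}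
    (hx : Valued.v x = 1) : ‖x‖ = 1 :=
  norm_adicCompletion_eq_one_iff.mpr hx

/-- **The idele norm of a unit idele is the norm of its archimedean coordinate**: `‖b‖ = N(ι(b_∞))`
for `b ∈ 𝕌_K`. [folklore] -/
theorem ideleNorm_of_mem_unitIdeles {b : ideleGroup K} (hb : b ∈ unitIdeles K) :
    (IdeleClassGroup.ideleNorm K b : ℝ) = mixedEmbedding.norm ((archUnitsOfIdele K b : (mixedSpace K)ˣ) : mixedSpace K) := by
  rw [coe_ideleNorm, GaloisRepresentations.ideleNorm, coe_archUnitsOfIdele, mixedEmbedding_norm_ringEquiv_mixedSpace,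
    finprod_eq_one_of_forall_eq_one fun v => norm_adicCompletion_eq_one_iff.mpr (GaloisRepresentations.mem_unitIdeles_iff.1 hb v), mul_one]

/-- `|(ϖ^m b)_v| ≤ 1` for all `v ∈ S'` iff `m ≥ 0`, for `b ∈ 𝕌_K`. [folklore] -/
theorem forall_valued_shellIdele_mul_le_one_iff (hϖ : ∀ v, Valued.v ((ϖ v : (v.adicCompletion K)ˣ) : v.adicCompletion K) = exp (-1 : ℤ))
    {S' : Finset (HeightOneSpectrum (𝓞 K))} (m : ↥S' → ℤ) {b : ideleGroup K} (hb : b ∈ unitIdeles K) :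
    (∀ v ∈ S', Valued.v ((((shellIdele ϖ S' m * b : ideleGroup K)) : AdeleRing (𝓞 K) K).2 v) ≤ 1) ↔ ∀ v, 0 ≤ m v := by
  constructor
  · intro h v
    have hv := h v.1 v.2
    rw [valued_shellIdele_mul_snd ϖ hϖ m hb v, ← exp_zero, exp_le_exp] at hv
    omega
  · intro h v hv
    rw [valued_shellIdele_mul_snd ϖ hϖ m hb ⟨v, hv⟩, ← exp_zero, exp_le_exp]
    have := h ⟨v, hv⟩; omega

end ShellNorm

/-! ### The second-coordinate integral -/

section Main

variable {K : Type} [Field K] [NumberField K]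
variable [MeasurableSpace (ideleGroup K)] [BorelSpace (ideleGroup K)]

attribute [local instance] secondCountableTopology_ideleGroup
attribute [local instance] Literature.MeasureTheory.Group.Units.borelSpace_of_isOpenEmbedding
  Literature.MeasureTheory.Group.hasSummableGeomSeries_of_finiteDimensional

/-- **The second torus coordinate integrates**: for a Haar measure `ν` on `𝕀_K`, a finite set `S'`,
`C ≥ 0` and `c > 0`,
`∫_{B(S'ᶜ)} C exp(-c‖ι(a_∞)‖) ‖a‖² 𝟙{|a|_v ≤ 1 ∀ v ∈ S'} dν(a) < ∞`. [cite: JacquetShalikaAJM1981, §4] -/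
theorem setLIntegral_ideleUnitBox_expWeight_lt_top (ν : Measure (ideleGroup K)) [IsFiniteMeasureOnCompacts ν] [ν.IsMulLeftInvariant]
    (S' : Finset (HeightOneSpectrum (𝓞 K))) {C c : ℝ} (hC : 0 ≤ C) (hc : 0 < c) :
    ∫⁻ a in ideleUnitBox (K := K) {w | w ∉ S'},
      ENNReal.ofReal (C * Real.exp (-(c * ‖((archUnitsOfIdele K a : (mixedSpace K)ˣ) : mixedSpace K)‖)) *
          (IdeleClassGroup.ideleNorm K a : ℝ) ^ 2) *
        (if ∀ v ∈ S', Valued.v (((a : ideleGroup K) : AdeleRing (𝓞 K) K).2 v) ≤ 1 then 1 else 0) ∂ν < ⊤ := by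
  obtain ⟨ϖ, hϖ⟩ := exists_uniformizers (K := K)
  haveI : BorelSpace (mixedSpace K)ˣ := Literature.MeasureTheory.Group.Units.borelSpace_of_isOpenEmbedding
  -- the archimedean factor and its pushforward constant
  set H : (mixedSpace K)ˣ → ℝ≥0∞ := fun x => ENNReal.ofReal (C * Real.exp (-(c * ‖(x : mixedSpace K)‖)) * mixedEmbedding.norm (x : mixedSpace K) ^ 2) with hH
  have hHm : Measurable H := by
    refine ENNReal.measurable_ofReal.comp ?_
    have hN : Continuous fun x : (mixedSpace K)ˣ => mixedEmbedding.norm (x : mixedSpace K) := by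
      have : Continuous fun x : mixedSpace K => ∏ w : InfinitePlace K, normAtPlace w x ^ mult w :=
        continuous_finsetProd _ fun w _ => (continuous_normAtPlace w).pow _
      have e : (mixedEmbedding.norm : mixedSpace K → ℝ) = fun x => ∏ w : InfinitePlace K, normAtPlace w x ^ mult w :=
        funext fun x => mixedEmbedding.norm_apply x
      exact (e ▸ this).comp Units.continuous_val
    exact ((continuous_const.mul (Real.continuous_exp.comp (continuous_const.mul (continuous_norm.comp Units.continuous_val)).neg)).mul
      (hN.pow 2)).measurable
  obtain ⟨c₂, hc₂⟩ := exists_setLIntegral_unitIdeles_eq_mul_lintegral_mixedUnits (K := K) ν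
  have hJ : ∫⁻ x, H x ∂mixedUnitsHaar K < ⊤ := by
    have h := lintegral_exp_neg_mul_norm_sq_lt_top K hc
    calc ∫⁻ x, H x ∂mixedUnitsHaar K
        = ∫⁻ x, ENNReal.ofReal C * ENNReal.ofReal (Real.exp (-(c * ‖(x : mixedSpace K)‖)) * mixedEmbedding.norm (x : mixedSpace K) ^ 2) ∂mixedUnitsHaar K := by
          refine lintegral_congr fun x => ?_
          rw [hH]; simp only
          rw [mul_assoc, ENNReal.ofReal_mul hC]
      _ = ENNReal.ofReal C * _ := lintegral_const_mul' _ _ ENNReal.ofReal_ne_top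
      _ < ⊤ := ENNReal.mul_lt_top ENNReal.ofReal_lt_top h
  -- the local factors
  set q : HeightOneSpectrum (𝓞 K) → ℝ≥0∞ := fun v => ENNReal.ofReal ((v.residueCard : ℝ)⁻¹) with hq
  have hq1 : ∀ v, q v < 1 := by
    intro v
    rw [hq]
    have h1 : (1 : ℝ) < v.residueCard := by exact_mod_cast v.one_lt_residueCard
    exact ENNReal.ofReal_lt_one.2 (inv_lt_one_of_one_lt₀ h1)
  set g : HeightOneSpectrum (𝓞 K) → ℤ → ℝ≥0∞ := fun v k => if 0 ≤ k then q v ^ (2 * k.toNat) else 0 with hg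
  -- shells
  rw [setLIntegral_ideleUnitBox_eq_tsum ϖ ν hϖ S']
  -- each shell
  have hterm : ∀ m : ↥S' → ℤ,
      ∫⁻ b in (unitIdeles K : Set (ideleGroup K)),
        ENNReal.ofReal (C * Real.exp (-(c * ‖((archUnitsOfIdele K (shellIdele ϖ S' m * b) : (mixedSpace K)ˣ) : mixedSpace K)‖)) *
            (IdeleClassGroup.ideleNorm K (shellIdele ϖ S' m * b) : ℝ) ^ 2) *
          (if ∀ v ∈ S', Valued.v ((((shellIdele ϖ S' m * b : ideleGroup K)) : AdeleRing (𝓞 K) K).2 v) ≤ 1 then 1 else 0) ∂ν =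
        (∏ v ∈ S'.attach, g v.1 (m v)) * (c₂ * ∫⁻ x, H x ∂mixedUnitsHaar K) := by
    intro m
    rw [← hc₂ H hHm, ← lintegral_const_mul' _ _ (ENNReal.prod_ne_top fun v _ => by simp only [hg]; split_ifs <;> simp [hq])]
    refine setLIntegral_congr_fun (GaloisRepresentations.isOpen_unitIdeles K).measurableSet fun b hb => ?_
    have hb' : b ∈ unitIdeles K := hb
    rw [archUnitsOfIdele_shellIdele_mul, map_mul, NNReal.coe_mul, ideleNorm_shellIdele ϖ hϖ, ideleNorm_of_mem_unitIdeles hb']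
    by_cases hm : ∀ v, 0 ≤ m v
    · rw [if_pos ((forall_valued_shellIdele_mul_le_one_iff ϖ hϖ m hb').2 hm), mul_one]
      have hprod : (∏ v ∈ S'.attach, g v.1 (m v)) = ENNReal.ofReal ((∏ v ∈ S'.attach, ((v.1.residueCard : ℝ)⁻¹) ^ (m v)) ^ 2) := by
        rw [← Finset.prod_pow, ENNReal.ofReal_prod_of_nonneg fun v _ => by positivity]
        refine Finset.prod_congr rfl fun v _ => ?_
        rw [hg]; simp only
        rw [if_pos (hm v), hq, ← ENNReal.ofReal_pow (by positivity), ← zpow_natCast, Nat.cast_mul, Nat.cast_two,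
          Int.toNat_of_nonneg (hm v), mul_comm, zpow_mul, zpow_two, ← pow_two]
      rw [hprod, hH]
      simp only
      rw [← ENNReal.ofReal_mul (by positivity)]
      congr 1
      ring
    · rw [if_neg (fun h => hm ((forall_valued_shellIdele_mul_le_one_iff ϖ hϖ m hb').1 h)), mul_zero]
      obtain ⟨v, hv⟩ := not_forall.1 hm
      rw [Finset.prod_eq_zero (Finset.mem_attach _ v) (by rw [hg]; simp only; rw [if_neg hv]), zero_mul]
  simp_rw [hterm]
  rw [ENNReal.tsum_mul_right, tsum_prod_shell_eq_prod_tsum g S']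
  refine ENNReal.mul_lt_top (ENNReal.prod_lt_top fun v _ => tsum_int_indicator_pow_lt_top (hq1 v)) ?_
  exact ENNReal.mul_lt_top ENNReal.coe_lt_top hJ

end Main

end Literature.NumberTheory.Automorphic
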